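import Literature.Topology.FourManifolds.FingerMonotone
import Literature.Topology.FourManifolds.K1Loop2
import HarnessLib

/-!
# The lower fingertip half of the controlled-descent profile is a graph over the twisted height

Topic `Literature/Topology/FourManifolds`; fact seat `provefact-IsStrictHandleSlide.isSurgery`
(R. C. Kirby, *The Topology of 4-Manifolds*, LNM 1374 (1989), Ch. I §4, Fig. 4.2; remaining content:
the named fact (S) `Literature.Topology.FourManifolds.FramedLink.IsStrictHandleSlide.slideModel`).
Glue between `K1Loop2.lean` (the fingertip radius `rsl` with its robust initial descent) and
`FingerMonotone.lean` (`FingerHyp`: a fingertip half is a `y`-graph): given the slice angle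
`Θ = 2π·thetaB - φ_axis` (strictly decreasing, vanishing at the axis height `h_A`, positive below
it, `Θ (h_D) < π`), a twist `c` satisfying the tip condition at `(r_D, Θ h_D)`, and the four
smallness conditions, the data `(rsl, Θ)` on `[h_D, h_A]` form a `FingerHyp`
(`K1Loop2Data.fingerHyp`), hence the twisted height `h ↦ rsl h · sin (twistAngle c (rsl h) (Θ h))`
is strictly decreasing on `[h_D, h_A]` (`K1Loop2Data.strictAntiOn_fingerY`).

## References

* R. C. Kirby, *The Topology of 4-Manifolds*, LNM 1374, Springer (1989), Ch. I §4. [Kirby1989]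
-/

open scoped Topology ContDiff
open Set Real Filter

noncomputable section

namespace Literature.Topology.FourManifolds

namespace K1Loop2Data

variable (L : K1Loop2Data)

/-- **Hypotheses on the slice angle and the twist for the lower fingertip half.** [cite: Kirby1989, Ch. I §4] -/
structure FingerAngleData where
  Θ : ℝ → ℝ
  c : ℝ
  hA : ℝ
  mΘ : ℝ
  MΘ : ℝ
  Θ_smooth : ContDiffOn ℝ ∞ Θ (Ioo (10⁻¹ : ℝ) (9 / 10))
  hgA : L.hg ≤ hA
  hA_le : hA ≤ L.hclu
  hA_win : hA < 0.85
  Θ_hA : Θ hA = 0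
  ΘD_lt : Θ L.hD < π
  mΘ_pos : 0 < mΘ
  Θ_deriv : ∀ h ∈ Icc L.hD hA, -MΘ ≤ deriv Θ h ∧ deriv Θ h ≤ -mΘ
  rD_le : L.rD ≤ 2
  tip : exp (c * L.rD) * tan (Θ L.hD / 2) = 1
  condF1 : |c| * (L.rD - 1) + exp (|c| * 2) / cos (Θ L.hD / 2) ^ 2 * MΘ * (L.hg - L.hD) ≤ 2⁻¹
  condF1' : 8 * |c| * (|c| * (L.rD - 1) + exp (|c| * 2) / cos (Θ L.hD / 2) ^ 2 * MΘ * (L.hg - L.hD)) ≤ 1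
  condF2 : 16 * (exp (|c| * 2) / cos (Θ L.hD / 2) ^ 2 * MΘ) *
    (|c| * (L.rD - 1) + exp (|c| * 2) / cos (Θ L.hD / 2) ^ 2 * MΘ * (L.hg - L.hD)) < L.lam
  condF3 : |c| * (L.rD - 1) < exp (-(|c| * 2)) * mΘ * (L.hg - L.hD)
  condF4 : (1 + L.CT) * L.lam * |c| < exp (-(|c| * 2)) * mΘ

variable {L} (D : L.FingerAngleData)

namespace FingerAngleData

/-- `hD_lt_hg` (auxiliary). [folklore] -/
theorem hD_lt_hg : L.hD < L.hg := by
  have h1 := L.hg_ge; have h2 := L.β_pos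
  show L.dl.Hh L.dl.tD < L.hg; linarith

/-- `hD_le_hA` (auxiliary). [folklore] -/
theorem hD_le_hA : L.hD ≤ D.hA := (hD_lt_hg (L := L)).le.trans D.hgA

/-- `Icc_sub_win` (auxiliary). [folklore] -/
theorem Icc_sub_win {h : ℝ} (hh : h ∈ Icc L.hD D.hA) : h ∈ Ioo (10⁻¹ : ℝ) (9 / 10) :=
  ⟨by linarith [L.hD_mem_win.1, hh.1], by linarith [D.hA_win, hh.2]⟩

/-- `hasDerivAt_Θ` (auxiliary). [folklore] -/
theorem hasDerivAt_Θ {h : ℝ} (hh : h ∈ Icc L.hD D.hA) : HasDerivAt D.Θ (deriv D.Θ h) h :=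
  ((D.Θ_smooth.differentiableOn (by simp)).differentiableAt
    (Ioo_mem_nhds (D.Icc_sub_win hh).1 (D.Icc_sub_win hh).2)).hasDerivAt

/-- The angle is strictly decreasing on `[h_D, h_A]`. [folklore] -/
theorem strictAntiOn_Θ : StrictAntiOn D.Θ (Icc L.hD D.hA) := by
  refine strictAntiOn_of_deriv_neg (convex_Icc _ _) (fun h hh ↦ (D.hasDerivAt_Θ hh).continuousAt.continuousWithinAt) ?_
  intro h hh
  rw [interior_Icc] at hh
  have := (D.Θ_deriv h (Ioo_subset_Icc_self hh)).2
  linarith [D.mΘ_pos]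

/-- **The `FingerHyp` of the lower fingertip half.** [cite: Kirby1989, Ch. I §4] -/
def fingerHyp : FingerHyp where
  c := D.c
  hD := L.hD
  hg := L.hg
  hA := D.hA
  r := L.rsl
  θ := D.Θ
  dr := deriv L.rsl
  dθ := deriv D.Θ
  rD := L.rD
  lam := L.lam
  mΘ := D.mΘ
  MΘ := D.MΘ
  hDg := hD_lt_hg
  hgA := D.hgA
  hasDeriv_r := fun h _ ↦ (L.contDiff_rsl.differentiable (by simp) h).hasDerivAt
  hasDeriv_θ := fun h hh ↦ D.hasDerivAt_Θ hh
  θ_mem := fun h hh ↦ ⟨by rw [← D.Θ_hA]; exact D.strictAntiOn_Θ.antitoneOn hh ⟨D.hD_le_hA, le_rfl⟩ hh.2,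
    D.strictAntiOn_Θ.antitoneOn ⟨le_rfl, D.hD_le_hA⟩ hh hh.1⟩
  θ_pos := fun h hh ↦ by
    rw [← D.Θ_hA]
    exact D.strictAntiOn_Θ ⟨hh.1, hh.2.le⟩ ⟨D.hD_le_hA, le_rfl⟩ hh.2
  θD_lt := D.ΘD_lt
  r_mem := fun h hh ↦ ⟨L.rlow_gt.le.trans (L.rsl_mem hh.1).1, (L.rsl_mem hh.1).2⟩
  rD_le := D.rD_le
  r_hD := L.rsl_hD
  dr_nonpos := fun h hh ↦ L.deriv_rsl_nonpos hh.1
  lam_pos := L.lam_pos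
  dr_le := fun h hh ↦ L.deriv_rsl_le hh
  Lam := (1 + L.CT) * L.lam
  dr_ge := fun h hh ↦ L.deriv_rsl_ge (by have := L.hg_ge; show L.dl.Hh L.dl.tD + L.β ≤ h; linarith [hh.1])
  mΘ_pos := D.mΘ_pos
  dθ_mem := D.Θ_deriv
  tip := D.tip
  condF1 := D.condF1
  condF1' := D.condF1'
  condF2 := D.condF2
  condF3 := D.condF3
  condF4 := D.condF4

/-- `fingerHyp_y` (auxiliary). [folklore] -/
@[simp] theorem fingerHyp_y (h : ℝ) : D.fingerHyp.y h = L.rsl h * sin (twistAngle D.c (L.rsl h) (D.Θ h)) := rfl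

/-- **The lower fingertip half is a graph over the twisted height.** [cite: Kirby1989, Ch. I §4] -/
theorem strictAntiOn_fingerY :
    StrictAntiOn (fun h ↦ L.rsl h * sin (twistAngle D.c (L.rsl h) (D.Θ h))) (Icc L.hD D.hA) :=
  D.fingerHyp.strictAntiOn_y

/-- At the tip the twisted height is `r_D`; on the half it lies in `[0, r_D]`. [folklore] -/
theorem fingerY_hD : L.rsl L.hD * sin (twistAngle D.c (L.rsl L.hD) (D.Θ L.hD)) = L.rD := D.fingerHyp.y_hD

/-- `fingerY_mem` (auxiliary). [folklore] -/
theorem fingerY_mem {h : ℝ} (hh : h ∈ Icc L.hD D.hA) :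
    L.rsl h * sin (twistAngle D.c (L.rsl h) (D.Θ h)) ∈ Icc 0 L.rD := D.fingerHyp.y_mem hh

/-- On the half the fingertip radius is the full profile radius `rstar` (the upper clamp is
inactive below `hclu ≥ h_A`). [folklore] -/
theorem rstar_eq_rsl {h : ℝ} (hh : h ∈ Icc L.hD D.hA) : L.rstar h = L.rsl h := L.rstar_of_le_hclu (hh.2.trans D.hA_le)

end FingerAngleData

end K1Loop2Data

end Literature.Topology.FourManifolds
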